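import Summits.ResolutionOfSingularities.ResolutionOfSingularities.Theorems.HilbertSamuelEliminationSigmaMaxModificationsMaxLocusClosed
import Summits.ResolutionOfSingularities.ResolutionOfSingularities.Theorems.HilbertSamuelEliminationSigmaMaxModificationsSemicontinuitySharp
import Literature.AlgebraicGeometry.Resolution.HilbertSamuelStrata
import Mathlib.AlgebraicGeometry.Morphisms.UniversallyClosed
import Mathlib.AlgebraicGeometry.Morphisms.FiniteType
import Mathlib.AlgebraicGeometry.Noetherian
import Mathlib.Topology.Irreducible
import HarnessLib

/-!
# Route `HilbertSamuelElimination`, crux `SigmaMaxModificationsCorridor3`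
# (stmt-ResolutionOfSingularities-19249; child of `SigmaMaxModifications` stmt-…-18506),
# line `tame_wild` v3: CONFINEMENT ladder, pieces of row C6 — the image `T` of the top stratum

[OURS · L1 W4.2] Topological pieces of the noetherian induction C6 (`L/w42/helpers-v3.1.lean`,
`stub_C6_confine3_of_confineRound`; CHAIN v3.1 §5, stub-1): along an `H^N`-monotone morphism
`f : Y' → Y` with `ν` maximal in `Σ_Y(N)`, the value `ν` stays maximal upstairs and the top stratum maps
into the stratum (`maximal_hsValues_of_hsFun_le`, `hsFun_base_eq_of_mem_hsStratum`); for `f` universally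
closed and `Y'` of finite type over a field with `dim Y' ≤ N`, the image `T = f(Y'(ν))` of the top stratum
is CLOSED (`isClosed_image_hsStratum_of_universallyClosed`: the maximal stratum upstairs is closed by the
landed upper semicontinuity over a field, `Sketch.stub_isClosed_hsMaxLocus_over_field` ∘
`stub_hsFun_le_of_specializes_over_field`); and a closed set containing a non-closed point contains a
non-closed point MAXIMAL for generisation inside it (`exists_maximal_not_isClosed_of_mem`, the generic point
of a maximal irreducible subset — Zorn, `exists_preirreducible` in the subspace). With C1
(`…Corridor3ConfinementLocal.lean`) these are the three topological inputs of the induction; the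
DECREASE `T' ⊆ T` along a round must be exported by the round lemma (flagged on STATUS: the typed
`ConfineRound` does not state it). NOT a statement of any manuscript.

## Sources

* V. Cossart, U. Jannsen, S. Saito, LNM 2270 (2020), Def. 2.28, Def. 2.35, Lemma 2.36, Rem. 6.29.
  [CossartJannsenSaito2020]
* The Stacks Project, Tags 0052, 004W (irreducible components). [StacksProject]
-/

set_option linter.dupNamespace false -- mandated namespace of this single-conjunct summit

noncomputable section

open CategoryTheory AlgebraicGeometry TopologicalSpace Topology Order
open Literature.AlgebraicGeometry.Resolution Literature.RingTheory.HilbertSamuel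
open Summit.ResolutionOfSingularities.ResolutionOfSingularities.Theorems.SigmaMaxModifications.Sketch

namespace Summit.ResolutionOfSingularities.ResolutionOfSingularities.Theorems.SigmaMaxModificationsCorridor3.Helpers

universe u

/-! ## A maximal value stays maximal along an `H`-monotone morphism -/

/-- **Along an `H^N`-monotone morphism a maximal value of the target that is attained upstairs is
maximal upstairs**: if `μ ∈ Σ_{Y'}(N)` dominates `ν` then `μ ≤ H_Y(f x') ∈ Σ_Y(N)` forces equality.
[OURS · L1 W4.2] piece of row C6; NOT a statement of the manuscript.
[cite: CossartJannsenSaito2020, Def. 2.35] -/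
theorem maximal_hsValues_of_hsFun_le {Y' Y : Scheme.{u}} (f : Y' ⟶ Y) (N : ℕ) {ν : ℕ → ℕ}
    (hν : Maximal (· ∈ Scheme.hsValues Y N) ν)
    (hmono : ∀ x' : Y', Scheme.hsFun Y' N x' ≤ Scheme.hsFun Y N (f.base x'))
    (hmem : ν ∈ Scheme.hsValues Y' N) : Maximal (· ∈ Scheme.hsValues Y' N) ν := by
  refine ⟨hmem, fun μ hμ hνμ => ?_⟩
  obtain ⟨x', rfl⟩ := hμ
  have h1 : ν ≤ Scheme.hsFun Y N (f.base x') := hνμ.trans (hmono x')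
  have h2 : Scheme.hsFun Y N (f.base x') ≤ ν := hν.2 ⟨f.base x', rfl⟩ h1
  exact (hmono x').trans h2

/-- **The top stratum maps into the stratum**: along an `H^N`-monotone `f` with `ν` maximal in
`Σ_Y(N)`, `H_Y(f x') = ν` for every `x' ∈ Y'(ν)`. [OURS · L1 W4.2] piece of row C6; NOT a statement
of the manuscript. [cite: CossartJannsenSaito2020, Def. 2.28, Def. 2.35] -/
theorem hsFun_base_eq_of_mem_hsStratum {Y' Y : Scheme.{u}} (f : Y' ⟶ Y) (N : ℕ) {ν : ℕ → ℕ}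
    (hν : Maximal (· ∈ Scheme.hsValues Y N) ν)
    (hmono : ∀ x' : Y', Scheme.hsFun Y' N x' ≤ Scheme.hsFun Y N (f.base x'))
    {x' : Y'} (hx' : x' ∈ Scheme.hsStratum Y' N ν) : Scheme.hsFun Y N (f.base x') = ν := by
  have h1 : ν ≤ Scheme.hsFun Y N (f.base x') := (le_of_eq hx'.symm).trans (hmono x')
  exact le_antisymm (hν.2 ⟨f.base x', rfl⟩ h1) h1

/-- The image of the top stratum lies in the stratum: `f(Y'(ν)) ⊆ Y(ν)`.
[OURS · L1 W4.2] piece of row C6; NOT a statement of the manuscript.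
[cite: CossartJannsenSaito2020, Def. 2.28] -/
theorem image_hsStratum_subset {Y' Y : Scheme.{u}} (f : Y' ⟶ Y) (N : ℕ) {ν : ℕ → ℕ}
    (hν : Maximal (· ∈ Scheme.hsValues Y N) ν)
    (hmono : ∀ x' : Y', Scheme.hsFun Y' N x' ≤ Scheme.hsFun Y N (f.base x')) :
    (fun x' => f.base x') '' Scheme.hsStratum Y' N ν ⊆ Scheme.hsStratum Y N ν := by
  rintro _ ⟨x', hx', rfl⟩
  exact hsFun_base_eq_of_mem_hsStratum f N hν hmono hx'

/-! ## The image of the top stratum is closed -/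

/-- **The stratum of a value maximal downstairs is closed upstairs** for `Y'` of finite type over a
field with `dim Y' ≤ N` and `f : Y' → Y` `H^N`-monotone: either `ν ∉ Σ_{Y'}(N)` (empty stratum) or
`ν` is maximal in `Σ_{Y'}(N)` and the landed upper semicontinuity over a field applies.
[OURS · L1 W4.2] piece of row C6; NOT a statement of the manuscript.
[cite: CossartJannsenSaito2020, Lemma 2.36 (a), Thm. 2.33] -/
theorem isClosed_hsStratum_of_hsFun_le {k : Type} [Field k] {Y' Y : Scheme.{0}}
    (g' : Y' ⟶ Spec (.of k)) [LocallyOfFiniteType g'] [QuasiCompact g'] (f : Y' ⟶ Y) (N : ℕ)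
    (hdim : topologicalKrullDim Y' ≤ (N : WithBot ℕ∞)) {ν : ℕ → ℕ}
    (hν : Maximal (· ∈ Scheme.hsValues Y N) ν)
    (hmono : ∀ x' : Y', Scheme.hsFun Y' N x' ≤ Scheme.hsFun Y N (f.base x')) :
    IsClosed (Scheme.hsStratum Y' N ν) := by
  by_cases hmem : ν ∈ Scheme.hsValues Y' N
  · have husc : ∀ μ : ℕ → ℕ, IsClosed (Scheme.hsStratumGE Y' N μ) :=
      (stub_isClosed_hsMaxLocus_over_field stub_hsFun_le_of_specializes_over_field k Y' g'
        inferInstance inferInstance N hdim).1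
    exact Scheme.isClosed_hsStratum_of_maximal husc (maximal_hsValues_of_hsFun_le f N hν hmono hmem)
  · have he : Scheme.hsStratum Y' N ν = ∅ :=
      Set.not_nonempty_iff_eq_empty.mp fun hne => hmem (Scheme.hsStratum_nonempty_iff.mp hne)
    rw [he]
    exact isClosed_empty

/-- **The image `T = f(Y'(ν))` of the top stratum under a universally closed `H^N`-monotone
morphism is closed** (`Y'` of finite type over a field, `dim Y' ≤ N`, `ν` maximal in `Σ_Y(N)`).
For a blow-up sequence `s` this is the set `T` of the confinement induction C6.
[OURS · L1 W4.2] piece of row C6; NOT a statement of the manuscript.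
[cite: CossartJannsenSaito2020, Lemma 2.36 (a), Rem. 6.29] -/
theorem isClosed_image_hsStratum_of_universallyClosed {k : Type} [Field k] {Y' Y : Scheme.{0}}
    (g' : Y' ⟶ Spec (.of k)) [LocallyOfFiniteType g'] [QuasiCompact g'] (f : Y' ⟶ Y)
    [UniversallyClosed f] (N : ℕ) (hdim : topologicalKrullDim Y' ≤ (N : WithBot ℕ∞)) {ν : ℕ → ℕ}
    (hν : Maximal (· ∈ Scheme.hsValues Y N) ν)
    (hmono : ∀ x' : Y', Scheme.hsFun Y' N x' ≤ Scheme.hsFun Y N (f.base x')) :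
    IsClosed ((fun x' => f.base x') '' Scheme.hsStratum Y' N ν) :=
  f.isClosedMap _ (isClosed_hsStratum_of_hsFun_le g' f N hdim hν hmono)

/-! ## Maximal non-closed points of a closed set -/

/-- **A closed subset containing a non-closed point contains a non-closed point which is maximal for
generisation inside it** (the generic point of a maximal irreducible subset of `T` through the given
point — Zorn, Mathlib `exists_preirreducible` in the subspace `T`; sobriety of schemes). These are the
points at which the confinement round C5 is applied. [OURS · L1 W4.2] piece of row C6; NOT a
statement of the manuscript. [cite: StacksProject, Tag 004W] -/
theorem exists_maximal_not_isClosed_of_mem {Y : Scheme.{u}} {T : Set Y} (hT : IsClosed T) {ξ₀ : Y}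
    (hξ₀T : ξ₀ ∈ T) (hξ₀ : ¬ IsClosed ({ξ₀} : Set Y)) :
    ∃ ξ ∈ T, ¬ IsClosed ({ξ} : Set Y) ∧ ∀ η ∈ T, η ⤳ ξ → η = ξ := by
  -- a maximal preirreducible subset `t` of the subspace `T` through `ξ₀`
  obtain ⟨t, htirr, hξ₀t, htmax⟩ :=
    exists_preirreducible ({⟨ξ₀, hξ₀T⟩} : Set T) isPreirreducible_singleton
  have hval : IsClosedEmbedding ((↑) : T → Y) := hT.isClosedEmbedding_subtypeVal
  -- `t` is closed in `T` (its closure is preirreducible and contains it)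
  have htcl : IsClosed t := by
    have h := htmax (closure t) htirr.closure subset_closure
    rw [← h]
    exact isClosed_closure
  -- its image `Z` is an irreducible closed subset of `Y` inside `T`
  set Z : Set Y := ((↑) : T → Y) '' t with hZ
  have hZne : Z.Nonempty := ⟨ξ₀, ⟨⟨ξ₀, hξ₀T⟩, hξ₀t (Set.mem_singleton _), rfl⟩⟩
  have hZirr : IsIrreducible Z :=
    ⟨hZne, htirr.image _ continuous_subtype_val.continuousOn⟩
  have hZcl : IsClosed Z := hval.isClosedMap t htcl
  have hZT : Z ⊆ T := by
    rintro _ ⟨z, -, rfl⟩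
    exact z.2
  have hξ₀Z : ξ₀ ∈ Z := ⟨⟨ξ₀, hξ₀T⟩, hξ₀t (Set.mem_singleton _), rfl⟩
  -- its generic point `ξ`
  obtain ⟨ξ, hξ⟩ : ∃ ξ : Y, IsGenericPoint ξ Z := by
    have h := hZirr.isGenericPoint_genericPoint_closure
    rw [hZcl.closure_eq] at h
    exact ⟨_, h⟩
  refine ⟨ξ, hZT hξ.mem, fun hcl => hξ₀ ?_, fun η hηT hηξ => ?_⟩
  · -- if `ξ` were closed, `Z = {ξ}` and `ξ₀ = ξ` would be closed
    have hZeq : Z = {ξ} := hξ.def.symm.trans hcl.closure_eq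
    have h0 : ξ₀ = ξ := by
      have h := hξ₀Z
      rw [hZeq] at h
      exact h
    rw [h0]
    exact hcl
  · -- a generisation `η ∈ T` of `ξ`: `closure {η} ∩ T` pulls back to a preirreducible subset of `T`
    -- containing `t`, hence equal to it by maximality, so `η ∈ Z = closure {ξ}`
    let u : Set T := ((↑) : T → Y) ⁻¹' closure {η}
    have hu : u = closure ({⟨η, hηT⟩} : Set T) := by
      rw [hval.isEmbedding.closure_eq_preimage_closure_image, Set.image_singleton]
    have huirr : IsPreirreducible u := by
      rw [hu]
      exact isPreirreducible_singleton.closure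
    have htu : t ⊆ u := by
      intro z hz
      show (z : Y) ∈ closure {η}
      have hzZ : (z : Y) ∈ Z := ⟨z, hz, rfl⟩
      rw [← hξ.def] at hzZ
      -- `ξ ⤳ z` and `η ⤳ ξ`
      exact (hηξ.trans (specializes_iff_mem_closure.mpr hzZ)).mem_closure
    have hut : u = t := htmax u huirr htu
    have hηu : (⟨η, hηT⟩ : T) ∈ u := by
      show η ∈ closure {η}
      exact subset_closure (Set.mem_singleton η)
    rw [hut] at hηu
    have hηZ : η ∈ Z := ⟨⟨η, hηT⟩, hηu, rfl⟩
    rw [← hξ.def] at hηZ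
    exact (hηξ.antisymm (specializes_iff_mem_closure.mpr hηZ)).eq

/-! ## The decrease `T' ⊆ T` along a round -/

/-- **The image of the top stratum decreases along an `H`-monotone extension of the tower.** Let
`c : X₁ → Y` be `H^N`-monotone with `ν` maximal in `Σ_Y(N)`, and let `c₂ : X₂ → Y` factor as
`c₂ = τ ≫ c` through an `H^N`-monotone `τ : X₂ → X₁` (e.g. `X₂ = (s.append t).top`, `X₁ = s.top`,
`τ` the composite of the appended blow-ups, monotone by CJS Thm. 3.10 (1)). Then
`c₂(X₂(ν)) ⊆ c(X₁(ν))`: a point of `X₂(ν)` maps under `τ` to a point of value `≥ ν`, hence `= ν`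
(`ν` is maximal in `Σ_{X₁}(N)` by `maximal_hsValues_of_hsFun_le`). This converts the clause exported by
the amended round lemma C5 (CHAIN v3.2: `H`-monotonicity along the appended round) into the decrease
`T' ⊆ T` consumed by the C6 induction (`…Corridor3ConfinementInduction.lean`). [OURS · L1 W4.2] piece
of row C6; NOT a statement of the manuscript. [cite: CossartJannsenSaito2020, Thm. 3.10 (1), Rem. 6.29] -/
theorem image_hsStratum_subset_of_fac {X₂ X₁ Y : Scheme.{u}} (c : X₁ ⟶ Y) (τ : X₂ ⟶ X₁)
    (c₂ : X₂ ⟶ Y) (hfac : τ ≫ c = c₂) (N : ℕ) {ν : ℕ → ℕ}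
    (hν : Maximal (· ∈ Scheme.hsValues Y N) ν)
    (hmono : ∀ x₁ : X₁, Scheme.hsFun X₁ N x₁ ≤ Scheme.hsFun Y N (c.base x₁))
    (hmonoτ : ∀ x₂ : X₂, Scheme.hsFun X₂ N x₂ ≤ Scheme.hsFun X₁ N (τ.base x₂)) :
    (fun x₂ => c₂.base x₂) '' Scheme.hsStratum X₂ N ν ⊆
      (fun x₁ => c.base x₁) '' Scheme.hsStratum X₁ N ν := by
  rintro _ ⟨x₂, hx₂, rfl⟩
  refine ⟨τ.base x₂, ?_, ?_⟩
  · -- `H_{X₁}(τ x₂) ≥ ν`, and `≤ ν` by maximality downstairs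
    have h1 : ν ≤ Scheme.hsFun X₁ N (τ.base x₂) := (le_of_eq hx₂.symm).trans (hmonoτ x₂)
    have h2 : Scheme.hsFun X₁ N (τ.base x₂) ≤ ν := by
      have h3 : ν ≤ Scheme.hsFun Y N (c.base (τ.base x₂)) := h1.trans (hmono _)
      exact (hmono _).trans (hν.2 ⟨_, rfl⟩ h3)
    exact le_antisymm h2 h1
  · show c.base (τ.base x₂) = c₂.base x₂
    rw [← hfac, Scheme.Hom.comp_base, TopCat.comp_app]

end Summit.ResolutionOfSingularities.ResolutionOfSingularities.Theorems.SigmaMaxModificationsCorridor3.Helpers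

end
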